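import Summits.AtomisticToContinuum.HydrodynamicLimit.Theorems.CollisionIsometryCLTDiffuseBackwardInfluenceOnePathScores

/-!
# `DiffuseBackwardInfluence`, line `share-nondegeneracy-one-flight`: the one-path bound (stub `stub_onePathBound`, 5/5)

The registered stub `stub_onePathBound : ∀ σ, RowBudgetN σ → OnePathBound σ` of crux stmt-AtomisticToContinuum-12950
(`--supports`), PATHWISE and free of measure theory. `ipr / 9` is the source average of the together-mass
`Σ_i μ_k(i)²` of two conditionally independent influence tracers of the source `k` (exact tracer duality: the exchange
rule of file 1/5). Per source (`source_bound`): together at the end ⇒ together and unsplit since the restart time `n₀`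
or merged at a late step (`excess_bound`); unsplit pairs die like `(1 − η)^{#scores}` (Invariant A, `pot_two_le`); fewer
than `m` scores in the `2m` late slots force `≥ m + 1` bad (idle or degenerate-first-collision) late slots, at most one
score per slot (`support_bound`) and Markov give `Σ_{late r} (1 − G_r)/(m + 1)`. Averaging over the sources with the ROW
budget (`RowBudgetN`, exact host uniformity — the stub's hypothesis) turns `1 − G_r` into `idleFr_r + degFr_r ≤ b`
(`sum_one_sub_Gr_le`) and the late merges into `lateMergeFr`, whence `ipr ≤ 9 ((1 − η)^m + 2 b + lateMergeFr) ≤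
9 (2 (1 − η)^m + 4 b + lateMergeFr)`.
-/

namespace Summit.AtomisticToContinuum.HydrodynamicLimit.Theorems.DiffuseBackwardInfluenceShare

open scoped BigOperators Topology ENNReal InnerProductSpace Classical
open Filter Set MeasureTheory
open Literature.Analysis.FluidPDE
open Literature.MathematicalPhysics.KineticTheory (localGibbsLaw hsDiameter)
open Summit.AtomisticToContinuum.HydrodynamicLimit.Theorems.DiffuseBackwardInfluenceNeg

noncomputable section

namespace OnePath

section Potentials

variable {N : ℕ} {C : Src N}

/-! ### The one-path bound for one source -/

/-- `n₀ ≤ fin` (window with at least one fold step). [folklore] -/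
theorem n0_le_fin (hΔ : 0 < C.Δ) (hpos : 0 < fin C) (hm : 1 ≤ C.m) (hL : 1 ≤ C.L) : n0 C ≤ fin C := by
  have hS : 0 < 2 * C.m * C.L := Nat.mul_pos (Nat.mul_pos (by norm_num) hm) hL
  unfold n0 nS fin
  rw [← slotStart_self (σ := C.σ) (y := C.y) (Δ := C.Δ) hS]
  exact slotStart_mono hΔ hpos hS (Nat.sub_le _ _) le_rfl

/-- THE ONE-PATH BOUND FOR ONE SOURCE (pathwise tracer duality): the together-mass of the two tracers of the
source at the end of the window is at most `(1 − η)^m` (never split, `≥ m` non-degenerate scores) plus the mean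
bad mass of the late slots over `m + 1` (Markov: `< m` scores force `≥ m + 1` bad late slots) plus the late
merge mass. [folklore] -/
theorem source_bound (hΔ : 0 < C.Δ) (hpos : 0 < fin C) (hm : 1 ≤ C.m) (hL : 1 ≤ C.L) (hη0 : 0 ≤ C.η)
    (hη1 : C.η ≤ 1) :
    ∑ i, mu C (fin C) i ^ 2 ≤ (1 - C.η) ^ C.m + (∑ r ∈ lateSet C, (1 - Gr C r)) / (C.m + 1) +
      ∑ c ∈ Finset.Ico (n0 C) (fin C), mergeAt C.σ N C.y C.k c := by
  have hn0 := n0_le_fin hΔ hpos hm hL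
  set T := fin C - n0 C with hT
  have hfin : fin C = n0 C + T := by omega
  rw [hfin]
  obtain ⟨_, hex⟩ := excess_bound (C := C) T T le_rfl
  have hA := pot_two_le (C := C) hη1 T
  have hM := first_moment (C := C) T T le_rfl
  have hG := sum_Gr_le (C := C) hΔ hpos
  rw [hfin, ← hM] at hG
  have hsum1 : ∀ i, ∑ j ∈ Finset.range (T + 1), pot C 1 T i j = mu C (n0 C + T) i := sum_pot_one T T le_rfl
  have htot : ∑ i, ∑ j ∈ Finset.range (T + 1), pot C 1 T i j = 1 := by
    rw [Finset.sum_congr rfl fun i _ => hsum1 i, sum_mu]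
  set c := 1 - C.η with hc
  have hc0 : 0 ≤ c := sub_nonneg.2 hη1
  have hc1 : c ≤ 1 := sub_le_self 1 hη0
  -- E1: together-mass ≤ never-split pair mass + merges
  have E1 : ∑ i, mu C (n0 C + T) i ^ 2 ≤
      ∑ i, ∑ j ∈ Finset.range (T + 1), pot C 2 T i j + ∑ c ∈ Finset.Ico (n0 C) (n0 C + T), mergeAt C.σ N C.y C.k c := by
    rw [Finset.sum_sub_distrib] at hex
    linarith
  -- E2: never-split pair mass ≤ A + c^m, A = single mass with < m scores
  set A := ∑ i, ∑ j ∈ Finset.range (T + 1), (if j < C.m then pot C 1 T i j else 0) with hAdef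
  have E2 : ∑ i, ∑ j ∈ Finset.range (T + 1), pot C 2 T i j ≤ A + c ^ C.m := by
    calc ∑ i, ∑ j ∈ Finset.range (T + 1), pot C 2 T i j
        ≤ ∑ i, ∑ j ∈ Finset.range (T + 1), ((if j < C.m then pot C 1 T i j else 0) + c ^ C.m * pot C 1 T i j) := by
          refine Finset.sum_le_sum fun i _ => Finset.sum_le_sum fun j _ => ?_
          have h1 := hA i j
          have hp := pot_nonneg (C := C) 1 T i j
          by_cases hjm : j < C.m
          · rw [if_pos hjm]
            have : c ^ j * pot C 1 T i j ≤ 1 * pot C 1 T i j :=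
              mul_le_mul_of_nonneg_right (pow_le_one₀ hc0 hc1) hp
            nlinarith [mul_nonneg (pow_nonneg hc0 C.m) hp]
          · rw [if_neg hjm, zero_add]
            have : c ^ j ≤ c ^ C.m := pow_le_pow_of_le_one hc0 hc1 (not_lt.1 hjm)
            exact h1.trans (mul_le_mul_of_nonneg_right this hp)
      _ = A + c ^ C.m * ∑ i, ∑ j ∈ Finset.range (T + 1), pot C 1 T i j := by
          rw [hAdef, Finset.mul_sum, ← Finset.sum_add_distrib]
          refine Finset.sum_congr rfl fun i _ => ?_
          rw [Finset.mul_sum, ← Finset.sum_add_distrib]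
      _ = A + c ^ C.m := by rw [htot, mul_one]
  -- E3 (Markov): (m + 1) A ≤ 2m − first moment
  have E3 : ((C.m : ℝ) + 1) * A ≤ 2 * (C.m : ℝ) - ∑ i, ∑ j ∈ Finset.range (T + 1), pot C 1 T i j * (j : ℝ) := by
    have hterm : ∀ i j, ((C.m : ℝ) + 1) * (if j < C.m then pot C 1 T i j else 0) ≤
        2 * (C.m : ℝ) * pot C 1 T i j - pot C 1 T i j * (j : ℝ) := by
      intro i j
      have hp := pot_nonneg (C := C) 1 T i j
      by_cases h0 : pot C 1 T i j = 0
      · rw [h0]; simp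
      have hj : j ≤ 2 * C.m := le_two_mul_of_pot_ne_zero hm hL h0
      have hj' : (j : ℝ) ≤ 2 * (C.m : ℝ) := by exact_mod_cast hj
      by_cases hjm : j < C.m
      · rw [if_pos hjm]
        have : (j : ℝ) + 1 ≤ (C.m : ℝ) := by exact_mod_cast Nat.succ_le_of_lt hjm
        nlinarith
      · rw [if_neg hjm, mul_zero]
        nlinarith
    calc ((C.m : ℝ) + 1) * A = ∑ i, ∑ j ∈ Finset.range (T + 1), ((C.m : ℝ) + 1) * (if j < C.m then pot C 1 T i j else 0) := by
          rw [hAdef, Finset.mul_sum]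
          refine Finset.sum_congr rfl fun i _ => ?_
          rw [Finset.mul_sum]
      _ ≤ ∑ i, ∑ j ∈ Finset.range (T + 1), (2 * (C.m : ℝ) * pot C 1 T i j - pot C 1 T i j * (j : ℝ)) :=
          Finset.sum_le_sum fun i _ => Finset.sum_le_sum fun j _ => hterm i j
      _ = 2 * (C.m : ℝ) * ∑ i, ∑ j ∈ Finset.range (T + 1), pot C 1 T i j -
            ∑ i, ∑ j ∈ Finset.range (T + 1), pot C 1 T i j * (j : ℝ) := by
          rw [Finset.mul_sum, ← Finset.sum_sub_distrib]
          refine Finset.sum_congr rfl fun i _ => ?_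
          rw [Finset.mul_sum, ← Finset.sum_sub_distrib]
      _ = _ := by rw [htot, mul_one]
  -- E4: first moment ≥ Σ_r G_r, and there are 2m late slots
  have hcard : ((lateSet C).card : ℝ) = 2 * (C.m : ℝ) := by
    rw [card_lateSet (C := C) hL]; push_cast; ring
  have E4 : ((C.m : ℝ) + 1) * A ≤ ∑ r ∈ lateSet C, (1 - Gr C r) := by
    rw [Finset.sum_sub_distrib, Finset.sum_const, nsmul_eq_mul, mul_one, hcard]
    linarith
  have hm1 : (0 : ℝ) < (C.m : ℝ) + 1 := by positivity
  have E5 : A ≤ (∑ r ∈ lateSet C, (1 - Gr C r)) / (C.m + 1) := by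
    rw [le_div_iff₀ hm1, mul_comm]
    exact E4
  linarith

end Potentials

/-! ## §5 Averaging over the sources with the row budget -/

section Average

variable {σ : ℝ} {N : ℕ}

/-- `degScore ≤ 1` under the row budget. [folklore] -/
theorem degScore_le_one (hRB : RowBudgetN σ) (y : Cfg N) (Δ : ℝ) (S r : ℕ) (η : ℝ) (i : Fin (N + 1)) :
    degScore σ N y Δ S r η i ≤ 1 := by
  unfold degScore
  by_cases h : HasCollIn σ N y Δ S r i
  · rw [dif_pos h]
    have hrow := hRB N y (Nat.find h) i
    calc ∑ k, blockMass σ N y (Nat.find h) i k / 3 *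
          (if Degenerate η (blockMass σ N y (Nat.find h) i k)
              (blockShare σ N y (Nat.find h) i k (unitNormal σ N y (Nat.find h))) then (1 : ℝ) else 0)
        ≤ ∑ k, blockMass σ N y (Nat.find h) i k / 3 := by
          refine Finset.sum_le_sum fun k _ => ?_
          have h3 : 0 ≤ blockMass σ N y (Nat.find h) i k / 3 := div_nonneg (blockMass_nonneg _ _ _ _ _ _) (by norm_num)
          split_ifs
          · rw [mul_one]
          · rw [mul_zero]; exact h3
      _ = 1 := by rw [← Finset.sum_div, hrow]; norm_num
  · rw [dif_neg h]
    exact zero_le_one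

/-- Under the row budget the truncation in `degFr` is inactive. [folklore] -/
theorem degFr_eq (hRB : RowBudgetN σ) (y : Cfg N) (Δ : ℝ) (S r : ℕ) (η : ℝ) :
    degFr σ N y Δ S r η = ((N + 1 : ℕ) : ℝ)⁻¹ * ∑ i : Fin (N + 1), degScore σ N y Δ S r η i := by
  unfold degFr
  refine min_eq_right ?_
  have hN : (0 : ℝ) < ((N + 1 : ℕ) : ℝ) := by positivity
  rw [inv_mul_le_iff₀ hN, mul_one]
  calc ∑ i : Fin (N + 1), degScore σ N y Δ S r η i ≤ ∑ _i : Fin (N + 1), (1 : ℝ) :=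
        Finset.sum_le_sum fun i _ => degScore_le_one hRB y Δ S r η i
    _ = ((N + 1 : ℕ) : ℝ) := by simp

/-- THE SOURCE AVERAGE OF THE GOOD MASSES (row budget = exact host uniformity):
`Σ_k G_r^{(k)} = #{i collides in slot r} − Σ_i degScore_r(i)`. [folklore] -/
theorem sum_Gr_eq (hRB : RowBudgetN σ) (y : Cfg N) (Δ η : ℝ) (m L r : ℕ) :
    ∑ k : Fin (N + 1), Gr (⟨σ, y, Δ, η, m, L, k⟩ : Src N) r =
      ∑ i : Fin (N + 1), ((if HasCollIn σ N y Δ (2 * m * L) r i then (1 : ℝ) else 0) -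
        degScore σ N y Δ (2 * m * L) r η i) := by
  simp only [Gr]
  rw [Finset.sum_comm]
  refine Finset.sum_congr rfl fun i _ => ?_
  by_cases h : HasCollIn σ N y Δ (2 * m * L) r i
  · have hc : ∀ k : Fin (N + 1), cfirst (⟨σ, y, Δ, η, m, L, k⟩ : Src N) r i = Nat.find h := fun k => by
      unfold cfirst
      exact dif_pos h
    have hg : ∀ k : Fin (N + 1), Good (⟨σ, y, Δ, η, m, L, k⟩ : Src N) r i ↔
        ¬ Degenerate η (blockMass σ N y (Nat.find h) i k)
          (blockShare σ N y (Nat.find h) i k (unitNormal σ N y (Nat.find h))) :=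
      fun k => ⟨fun ⟨_, hq⟩ => hq, fun hq => ⟨h, hq⟩⟩
    unfold degScore
    rw [dif_pos h, if_pos h]
    simp only [hc, hg, mu]
    have hrow := hRB N y (Nat.find h) i
    rw [eq_sub_iff_add_eq, ← Finset.sum_add_distrib]
    calc ∑ k : Fin (N + 1), ((if ¬ Degenerate η (blockMass σ N y (Nat.find h) i k)
              (blockShare σ N y (Nat.find h) i k (unitNormal σ N y (Nat.find h)))
            then blockMass σ N y (Nat.find h) i k / 3 else 0) +
          blockMass σ N y (Nat.find h) i k / 3 *
            (if Degenerate η (blockMass σ N y (Nat.find h) i k)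
                (blockShare σ N y (Nat.find h) i k (unitNormal σ N y (Nat.find h))) then 1 else 0))
        = ∑ k : Fin (N + 1), blockMass σ N y (Nat.find h) i k / 3 :=
          Finset.sum_congr rfl fun k _ => by split_ifs <;> ring
      _ = 1 := by rw [← Finset.sum_div, hrow]; norm_num
  · unfold degScore
    rw [dif_neg h, if_neg h, zero_sub, eq_neg_iff_add_eq_zero, add_zero]
    refine Finset.sum_eq_zero fun k _ => ?_
    rw [if_neg]
    rintro ⟨h', _⟩
    exact h h'

/-- THE SOURCE AVERAGE OF THE BAD MASSES is paid by the slot statistics: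
`(N+1)⁻¹ Σ_k (1 − G_r^{(k)}) ≤ idleFr_r + degFr_r`. [folklore] -/
theorem sum_one_sub_Gr_le (hRB : RowBudgetN σ) (y : Cfg N) (Δ η : ℝ) (m L r : ℕ) :
    ∑ k : Fin (N + 1), (1 - Gr (⟨σ, y, Δ, η, m, L, k⟩ : Src N) r) ≤
      ((N + 1 : ℕ) : ℝ) * (idleFr σ N y Δ (2 * m * L) r + degFr σ N y Δ (2 * m * L) r η) := by
  have hN : (0 : ℝ) < ((N + 1 : ℕ) : ℝ) := by positivity
  rw [Finset.sum_sub_distrib, sum_Gr_eq hRB, Finset.sum_sub_distrib, Finset.sum_boole, degFr_eq hRB, mul_add,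
    ← mul_assoc, mul_inv_cancel₀ hN.ne', one_mul]
  unfold idleFr
  rw [mul_div_cancel₀ _ hN.ne']
  have hcard : ((Finset.univ.filter fun i : Fin (N + 1) => IdleOn σ N y Δ (2 * m * L) r i).card : ℝ) +
      ((Finset.univ.filter fun i : Fin (N + 1) => HasCollIn σ N y Δ (2 * m * L) r i).card : ℝ) = ((N + 1 : ℕ) : ℝ) := by
    have h1 : (Finset.univ.filter fun i : Fin (N + 1) => IdleOn σ N y Δ (2 * m * L) r i) =
        (Finset.univ.filter fun i : Fin (N + 1) => ¬ HasCollIn σ N y Δ (2 * m * L) r i) :=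
      Finset.filter_congr fun i _ => idleOn_iff_not_hasCollIn y Δ _ r i
    rw [h1, add_comm]
    exact_mod_cast (Finset.card_filter_add_card_filter_not
      (s := (Finset.univ : Finset (Fin (N + 1)))) (fun i => HasCollIn σ N y Δ (2 * m * L) r i)).trans (by simp)
  simp only [Finset.sum_const, Finset.card_univ, Fintype.card_fin, nsmul_eq_mul, mul_one]
  linarith

end Average

end OnePath

/-! ## §6 The stub -/

open OnePath in
/-- **THE ONE-PATH BOUND, PATHWISE** (registered stub `stub_onePathBound` of the line
`share-nondegeneracy-one-flight` of crux `DiffuseBackwardInfluence`): under exact host uniformity (`RowBudgetN`), for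
every configuration, window `Δ > 0`, threshold `η ∈ (0,1)`, depth `m ≥ 1`, `L ≥ 1` and level `b` dominating
`idleFr_r + degFr_r` on each of the `2mL` slots, `ipr ≤ 9 (2 (1 − η)^m + 4 b + lateMergeFr L)`.
Proof: `ipr / 9` is the source average of the together-mass `Σ_i μ_k(i)²` of two conditionally independent
influence tracers (exchange rule `blockMass_succ_fst/snd`); per source, the restart bound (`excess_bound`),
Invariant A (`pot_two_le`), at most one score per slot (`support_bound`) and Markov (`source_bound`) give
`≤ (1 − η)^m + Σ_{late r} (1 − G_r)/(m+1) + late merges`; averaging over the sources with the row budget turns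
`1 − G_r` into `idleFr_r + degFr_r ≤ b` (`sum_one_sub_Gr_le`) and the late merges into `lateMergeFr`. [folklore] -/
theorem stub_onePathBound : ∀ σ : ℝ, RowBudgetN σ → OnePathBound σ := by
  intro σ hRB N y Δ hΔ η hη0 hη1 m L hm hL b hb
  have hS : 0 < 2 * m * L := Nat.mul_pos (Nat.mul_pos (by norm_num) hm) hL
  have hN : (0 : ℝ) < ((N + 1 : ℕ) : ℝ) := by positivity
  have hb0 : 0 ≤ b :=
    le_trans (add_nonneg (idleFr_nonneg σ N y Δ _ 0) (degFr_nonneg σ N y Δ _ 0 η)) (hb 0 hS)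
  have hLM : 0 ≤ lateMergeFr σ N y Δ L := mul_nonneg (inv_nonneg.2 hN.le) (Finset.sum_nonneg fun k _ =>
    Finset.sum_nonneg fun c _ => mergeAt_src_nonneg (C := (⟨σ, y, Δ, η, m, L, k⟩ : Src N)) c)
  have hpow : 0 ≤ (1 - η) ^ m := pow_nonneg (by linarith) _
  by_cases hfin : colls σ N y Δ = 0
  · -- no fold step: `ipr = 9`, and the last slot is empty so `b ≥ 1`
    rw [ipr_eq_nine_of_colls_eq_zero hfin]
    have hidle : idleFr σ N y Δ (2 * m * L) (2 * m * L - 1) = 1 := by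
      unfold idleFr
      have hall : (Finset.univ.filter fun i : Fin (N + 1) => IdleOn σ N y Δ (2 * m * L) (2 * m * L - 1) i) =
          Finset.univ := by
        refine Finset.filter_true_of_mem fun i _ => ?_
        intro k _ hk2
        rw [Nat.sub_add_cancel hS, slotStart_self hS, hfin] at hk2
        exact absurd hk2 (Nat.not_lt_zero _)
      rw [hall, Finset.card_univ, Fintype.card_fin]
      exact div_self hN.ne'
    have h1 : 1 ≤ b := by
      have := hb (2 * m * L - 1) (Nat.sub_lt hS Nat.one_pos)
      rw [hidle] at this
      linarith [degFr_nonneg σ N y Δ (2 * m * L) (2 * m * L - 1) η]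
    nlinarith
  · have hpos : 0 < colls σ N y Δ := Nat.pos_of_ne_zero hfin
    -- the data of source k
    set C : Fin (N + 1) → Src N := fun k => ⟨σ, y, Δ, η, m, L, k⟩ with hC
    -- per-source bound, in block-mass form
    have hT : ∀ k : Fin (N + 1), ∑ i, blockMass σ N y (colls σ N y Δ) i k ^ 2 ≤
        9 * ((1 - η) ^ m + (∑ r ∈ lateSet (C k), (1 - Gr (C k) r)) / (m + 1) +
          ∑ c ∈ Finset.Ico (colls σ N y ((1 - 1 / (L : ℝ)) * Δ)) (colls σ N y Δ), mergeAt σ N y k c) := by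
      intro k
      have h := source_bound (C := C k) hΔ hpos hm hL hη0.le hη1.le
      have hn0 : n0 (C k) = colls σ N y ((1 - 1 / (L : ℝ)) * Δ) := slotStart_restart hm hL
      have e1 : (C k).σ = σ := rfl
      have e2 : (C k).y = y := rfl
      have e3 : (C k).k = k := rfl
      have e4 : (C k).η = η := rfl
      have e5 : (C k).m = m := rfl
      have e6 : fin (C k) = colls σ N y Δ := rfl
      rw [hn0] at h
      simp only [e1, e2, e3, e4, e5, e6] at h
      have hmu : ∀ i, blockMass σ N y (colls σ N y Δ) i k ^ 2 = 9 * mu (C k) (colls σ N y Δ) i ^ 2 := fun i => by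
        simp only [mu, hC]
        ring
      rw [Finset.sum_congr rfl fun i _ => hmu i, ← Finset.mul_sum]
      linarith
    -- averaged bad masses
    have hB : ∀ r ∈ lateSet (C 0), ∑ k : Fin (N + 1), (1 - Gr (C k) r) ≤ ((N + 1 : ℕ) : ℝ) * b := by
      intro r hr
      have hr' : r < 2 * m * L := ((mem_lateSet (C := C 0)).1 hr).2
      calc ∑ k : Fin (N + 1), (1 - Gr (C k) r)
          ≤ ((N + 1 : ℕ) : ℝ) * (idleFr σ N y Δ (2 * m * L) r + degFr σ N y Δ (2 * m * L) r η) :=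
            sum_one_sub_Gr_le hRB y Δ η m L r
        _ ≤ ((N + 1 : ℕ) : ℝ) * b := mul_le_mul_of_nonneg_left (hb r hr') hN.le
    have hlate : ∀ k, lateSet (C k) = lateSet (C 0) := fun k => rfl
    have hcard : ((lateSet (C 0)).card : ℝ) = 2 * (m : ℝ) := by
      rw [card_lateSet (C := C 0) hL]; push_cast; ring
    -- sum over the sources
    have hsumB : ∑ k : Fin (N + 1), ∑ r ∈ lateSet (C k), (1 - Gr (C k) r) ≤ 2 * (m : ℝ) * (((N + 1 : ℕ) : ℝ) * b) := by
      simp only [hlate]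
      rw [Finset.sum_comm]
      calc ∑ r ∈ lateSet (C 0), ∑ k : Fin (N + 1), (1 - Gr (C k) r) ≤ ∑ _r ∈ lateSet (C 0), ((N + 1 : ℕ) : ℝ) * b :=
            Finset.sum_le_sum hB
        _ = 2 * (m : ℝ) * (((N + 1 : ℕ) : ℝ) * b) := by rw [Finset.sum_const, nsmul_eq_mul, hcard]
    have hLMeq : ∑ k : Fin (N + 1), ∑ c ∈ Finset.Ico (colls σ N y ((1 - 1 / (L : ℝ)) * Δ)) (colls σ N y Δ),
        mergeAt σ N y k c = ((N + 1 : ℕ) : ℝ) * lateMergeFr σ N y Δ L := by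
      unfold lateMergeFr
      rw [← mul_assoc, mul_inv_cancel₀ hN.ne', one_mul]
    have hm1 : (0 : ℝ) < (m : ℝ) + 1 := by positivity
    have hfrac : 2 * (m : ℝ) / ((m : ℝ) + 1) ≤ 2 := by
      rw [div_le_iff₀ hm1]; linarith
    -- assemble
    rw [ipr_eq_blockMass, Finset.sum_comm]
    have htot : ∑ k : Fin (N + 1), ∑ i, blockMass σ N y (colls σ N y Δ) i k ^ 2 ≤
        ((N + 1 : ℕ) : ℝ) * (9 * ((1 - η) ^ m + 2 * b + lateMergeFr σ N y Δ L)) := by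
      calc ∑ k : Fin (N + 1), ∑ i, blockMass σ N y (colls σ N y Δ) i k ^ 2
          ≤ ∑ k : Fin (N + 1), 9 * ((1 - η) ^ m + (∑ r ∈ lateSet (C k), (1 - Gr (C k) r)) / (m + 1) +
              ∑ c ∈ Finset.Ico (colls σ N y ((1 - 1 / (L : ℝ)) * Δ)) (colls σ N y Δ), mergeAt σ N y k c) :=
            Finset.sum_le_sum fun k _ => hT k
        _ = 9 * (((N + 1 : ℕ) : ℝ) * (1 - η) ^ m +
              (∑ k : Fin (N + 1), ∑ r ∈ lateSet (C k), (1 - Gr (C k) r)) / (m + 1) +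
              ((N + 1 : ℕ) : ℝ) * lateMergeFr σ N y Δ L) := by
            rw [← Finset.mul_sum, Finset.sum_add_distrib, Finset.sum_add_distrib, Finset.sum_const, Finset.card_univ,
              Fintype.card_fin, nsmul_eq_mul, ← Finset.sum_div, hLMeq]
        _ ≤ 9 * (((N + 1 : ℕ) : ℝ) * (1 - η) ^ m + (2 * (m : ℝ) * (((N + 1 : ℕ) : ℝ) * b)) / (m + 1) +
              ((N + 1 : ℕ) : ℝ) * lateMergeFr σ N y Δ L) := by
            gcongr
        _ = ((N + 1 : ℕ) : ℝ) * (9 * ((1 - η) ^ m + (2 * (m : ℝ) / ((m : ℝ) + 1)) * b + lateMergeFr σ N y Δ L)) := by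
            ring
        _ ≤ ((N + 1 : ℕ) : ℝ) * (9 * ((1 - η) ^ m + 2 * b + lateMergeFr σ N y Δ L)) := by
            gcongr
    rw [inv_mul_le_iff₀ hN]
    refine htot.trans ?_
    nlinarith

end

end Summit.AtomisticToContinuum.HydrodynamicLimit.Theorems.DiffuseBackwardInfluenceShare
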